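import Summits.ValiantsHypothesis.ValiantsHypothesis.Theorems.BarrierLeverChowBenchmarkPairsGeneralNoGo

/-!
# Route BarrierLever — item 22038 `ChowBenchmarkPairs`, line `moore-peel`: the SUPPORT-CROWDING no-go — too many points supported
# inside one coordinate set

Helper file (`--supports stmt-ValiantsHypothesis-22038`; cell valiant-natproofs, rung V4, 𝒟-side benchmark of record; seat val-np-p4 gen 20;
sixth of the no-go files, companion of `…Crowding` (p636017)).  Closes NO item; definition-free.

THE RULE (design rule R6).  Let `D` be a set of coordinates, `A` the set of points of the table supported inside `D` (`P a x = 0` for `x ∉ D`),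
`m = |A|`, and `N(D)` the number of benchmark columns (binary codes `< r`) supported inside `D`.  The `1 + m + C(m,2)` rows `S ⊆ A`, `|S| ≤ 2`,
all live in the `N(D)`-dimensional coordinate subspace spanned by the columns inside `D` (`segMatrix_entry_eq_zero_of_not_subset`), so if
`1 + m + C(m,2) > N(D)` the segment-moment matrix is singular (`det_segMatrix_eq_zero_of_support_crowding`, `det_eq_zero_of_support_crowding`).
Instances: `|D| = 1` ⇒ at most one point on a coordinate axis (= collinear with the origin, p634512); a coupled pair `D = {u,v}` (so `N(D) = 4`)
carries at most two points; `|D| = 3` at most three; etc.  In the g20 completeness census of 0/1 designs (h = 5 exhaustive) this rule accounts for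
1 144 of the 2 840 singular designs (second only to the mixed zeon-orthogonality rule).

WHAT THIS IS NOT: a constraint on witnesses of the ∀h stubs only; no stub of the line is closed; nothing on items 20172 / 19717, crux
stmt-ValiantsHypothesis-14610, or `VP` versus `VNP`.
-/

set_option linter.dupNamespace false

namespace Summit.ValiantsHypothesis.ValiantsHypothesis.Theorems.BarrierLever.ChowBenchmarkHyperplane

open Finset Module
open Summit.ValiantsHypothesis.ValiantsHypothesis.Theorems.BarrierLever.MoorePeel (benchCols eq_empty_or_singleton_or_pair)

variable {h : ℕ}

noncomputable section

/-- **Rows of points supported in `D` vanish outside the columns inside `D`.**  If every point of `u i` (a set of size `≤ 2`) is supported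
inside `D` and the column `T_j ⊄ D`, then the entry `(i, j)` of the segment-moment matrix is `0`. -/
theorem segMatrix_entry_eq_zero_of_not_subset {r : ℕ} (P : Fin h → Fin h → ℂ) (u : Fin r → Finset (Fin h)) (D : Finset (Fin h))
    {i : Fin r} (hcard : (u i).card ≤ 2) (hsupp : ∀ a ∈ u i, ∀ x, x ∉ D → P a x = 0) {j : Fin r}
    (hj : ¬ benchCols h r j ⊆ D) : segMatrix r P u i j = 0 := by
  classical
  obtain ⟨x, hxT, hxD⟩ : ∃ x ∈ benchCols h r j, x ∉ D := Finset.not_subset.mp hj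
  rcases eq_empty_or_singleton_or_pair (u i) hcard with h0 | ⟨a, ha⟩ | ⟨a, b, hab, habi⟩
  · have e := congr_fun (segMatrix_row_empty P u h0) j
    rw [Matrix.row_apply] at e
    rw [e]
    show (if benchCols h r j = ∅ then (1 : ℂ) else 0) = 0
    rw [if_neg (Finset.nonempty_iff_ne_empty.mp ⟨x, hxT⟩)]
  · have e := congr_fun (segMatrix_row_singleton P u ha) j
    rw [Matrix.row_apply] at e
    rw [e]
    show ((benchCols h r j).card.factorial : ℂ) * ∏ c ∈ benchCols h r j, P a c = 0
    rw [Finset.prod_eq_zero hxT (hsupp a (by rw [ha]; simp) x hxD), mul_zero]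
  · rw [segMatrix_row_pair P u (ne_of_lt hab) habi j]
    unfold pairSum
    refine Finset.sum_eq_zero fun d hd => ?_
    have hdT : d ⊆ benchCols h r j := Finset.mem_powerset.mp hd
    by_cases hxd : x ∈ d
    · rw [Finset.prod_eq_zero hxd (hsupp a (by rw [habi]; simp) x hxD), zero_mul, mul_zero]
    · have hx' : x ∈ benchCols h r j \ d := Finset.mem_sdiff.mpr ⟨hxT, hxd⟩
      rw [Finset.prod_eq_zero hx' (hsupp b (by rw [habi]; simp) x hxD), mul_zero, mul_zero]

/-- **Support crowding kills the table (matrix form).**  `D` a coordinate set, `A` a set of points all supported inside `D`; if the number of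
subsets of `A` of size `≤ 2` exceeds the number of benchmark columns inside `D`, then for every enumeration `uu` hitting all sets of size `≤ 2`
the segment-moment matrix has determinant `0`. -/
theorem det_segMatrix_eq_zero_of_support_crowding {r : ℕ} (P : Fin h → Fin h → ℂ) (D A : Finset (Fin h))
    (hA : ∀ a ∈ A, ∀ x, x ∉ D → P a x = 0)
    (hN : (Finset.univ.filter fun j : Fin r => benchCols h r j ⊆ D).card < (A.powerset.filter fun S => S.card ≤ 2).card)
    (uu : Fin r → Finset (Fin h)) (hsurj : ∀ S : Finset (Fin h), S.card ≤ 2 → ∃ i, uu i = S) :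
    (segMatrix r P uu).det = 0 := by
  classical
  by_contra hdet
  set M := segMatrix r P uu with hM
  have hU : IsUnit M := (Matrix.isUnit_iff_isUnit_det M).mpr (isUnit_iff_ne_zero.mpr hdet)
  have hli : LinearIndependent ℂ M.row := Matrix.linearIndependent_rows_of_isUnit hU
  -- the small sets of A and their row indices
  let 𝒮 : Finset (Finset (Fin h)) := A.powerset.filter fun S => S.card ≤ 2
  have hidx : ∀ S : ↥𝒮, ∃ i, uu i = S.1 := fun S => hsurj S.1 (Finset.mem_filter.mp S.2).2
  choose idx hidx using hidx
  have hinj : Function.Injective idx := by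
    intro S S' e
    apply Subtype.ext
    rw [← hidx S, ← hidx S', e]
  -- the restricted family is linearly independent
  have hli' : LinearIndependent ℂ (fun S : ↥𝒮 => M.row (idx S)) := hli.comp idx hinj
  -- and lives in the coordinate subspace of the columns inside D
  let J : Type := {j : Fin r // benchCols h r j ⊆ D}
  let Y : Submodule ℂ (Fin r → ℂ) := Submodule.span ℂ (Set.range fun j : J => (Pi.single j.1 (1 : ℂ) : Fin r → ℂ))
  have hrowsY : ∀ S : ↥𝒮, M.row (idx S) ∈ Y := by
    intro S
    have hSA : S.1 ⊆ A := Finset.mem_powerset.mp (Finset.mem_filter.mp S.2).1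
    have hScard : S.1.card ≤ 2 := (Finset.mem_filter.mp S.2).2
    have hzero : ∀ j : Fin r, ¬ benchCols h r j ⊆ D → M (idx S) j = 0 := by
      intro j hj
      rw [hM]
      refine segMatrix_entry_eq_zero_of_not_subset P uu D (by rw [hidx S]; exact hScard) ?_ hj
      intro a ha x hx
      rw [hidx S] at ha
      exact hA a (hSA ha) x hx
    have e : M.row (idx S) = ∑ j : Fin r, M (idx S) j • (Pi.single j (1 : ℂ) : Fin r → ℂ) := by
      funext j'
      simp only [Matrix.row_apply, Finset.sum_apply, Pi.smul_apply, smul_eq_mul]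
      rw [Finset.sum_eq_single j' (fun j _ hne => by rw [Pi.single_eq_of_ne' hne, mul_zero]) (fun h' => absurd (Finset.mem_univ _) h')]
      simp
    rw [e]
    refine Submodule.sum_mem _ fun j _ => ?_
    by_cases hj : benchCols h r j ⊆ D
    · exact Submodule.smul_mem _ _ (Submodule.subset_span ⟨⟨j, hj⟩, rfl⟩)
    · rw [hzero j hj, zero_smul]; exact Submodule.zero_mem _
  -- count
  have h1 : finrank ℂ (Submodule.span ℂ (Set.range fun S : ↥𝒮 => M.row (idx S))) = Fintype.card ↥𝒮 :=
    finrank_span_eq_card hli'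
  have h2 : Submodule.span ℂ (Set.range fun S : ↥𝒮 => M.row (idx S)) ≤ Y :=
    Submodule.span_le.mpr (by rintro _ ⟨S, rfl⟩; exact hrowsY S)
  have h3 : finrank ℂ Y ≤ Fintype.card J := finrank_range_le_card (R := ℂ) _
  have h4 := Submodule.finrank_mono h2
  have h5 : Fintype.card J = (Finset.univ.filter fun j : Fin r => benchCols h r j ⊆ D).card := Fintype.card_subtype _
  have h6 : Fintype.card ↥𝒮 = 𝒮.card := Fintype.card_coe 𝒮
  have h7 : 𝒮.card = (A.powerset.filter fun S => S.card ≤ 2).card := rfl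
  rw [h1] at h4
  omega

/-- **Support crowding — the line's form.**  A table with more than `N(D)` "small rows" supported inside a coordinate set `D` (for a coupled
pair `D`: three points supported in `D`) is never a witness of `stub_segmentMeanValue` / `stub_s10` / `stub_zeroOneDesign`. -/
theorem det_eq_zero_of_support_crowding {r : ℕ} (P : Fin h → Fin h → ℂ) (D A : Finset (Fin h))
    (hA : ∀ a ∈ A, ∀ x, x ∉ D → P a x = 0)
    (hN : (Finset.univ.filter fun j : Fin r => benchCols h r j ⊆ D).card < (A.powerset.filter fun S => S.card ≤ 2).card)
    (uu : Fin r → Finset (Fin h)) (hsurj : ∀ S : Finset (Fin h), S.card ≤ 2 → ∃ i, uu i = S) :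
    (Matrix.of fun i j : Fin r =>
      ∑ g : (↥(benchCols h r j) → ↥(uu i)), (∏ c : ↥(benchCols h r j), P (g c) c) *
        ∏ a : ↥(uu i), ((Finset.univ.filter fun c : ↥(benchCols h r j) => g c = a).card.factorial : ℂ)).det = 0 :=
  det_segMatrix_eq_zero_of_support_crowding P D A hA hN uu hsurj

end

end Summit.ValiantsHypothesis.ValiantsHypothesis.Theorems.BarrierLever.ChowBenchmarkHyperplane
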